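import Summits.AnomalousDissipation.AnomalousDissipation.Theorems.SawtoothPulseCascadeK1LocalisedCascadePhaseOneHFibre

/-!
# K1loc, line `Spectral` / thin start — helper: THE PER-FIBRE T-H BOUND IN EVALUATION FORM («PhaseOneHFibreEval», D4 frame)

Helper file of the prover lane on the crux `K1LocalisedCascade` (stmt-AnomalousDissipation-19491), route `SawtoothPulseCascade`
(glue seat; arbiter A24-2 (2)).  `…PhaseOneHFibre.phaseOne_hfibre_sqrt_le` restated with the two source sums indexed by
`Finset.range` (so that `simp only [Finset.sum_range_succ]` + `norm_num` evaluate them in the generated per-fibre files) and with the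
numeric side conditions collected:
* `sum_Icc_one_eq_sum_range`, `sum_Ioc_eq_sum_range`: `Σ_{q=1}^{Q} f q = Σ_{i<Q} f (i+1)`, `Σ_{q=Q₁+1}^{Q} f q = Σ_{i<Q−Q₁} f (Q₁+1+i)`;
* **`phaseOne_hfibre_sqrt_le_eval`**: for a fibre `n ≥ 1` with data `(Q₁, K₁, K, s)` and a value `v` dominating
  `2(s + 2⁻²⁷n)·Σ_{i<Q₁} Ā(n,i+1) + 2·Σ_{i<Q_c−Q₁} Ā(n,Q₁+1+i)`, `√X_n ≤ v + ρ_n`;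
* `phaseOne_hfibre_sq_le_eval`: the squared form `X_n ≤ 5/4·v² + 5·ρ_n²` (`(v+ρ)² ≤ (1+t)v² + (1+1/t)ρ²`, `t = ¼`).
No definitions; nothing about the crux. [cite: Grafakos2014, Prop. 3.1.2 (5), Prop. 3.2.7 (3)] [problem: turb]
-/

-- `Summit.<Summit>.<Problem>`: single-conjunct summit, the duplicate namespace segment is deliberate.
set_option linter.dupNamespace false

noncomputable section

namespace Summit.AnomalousDissipation.AnomalousDissipation.Theorems.SawtoothPulseCascade.K1Start

open MeasureTheory Filter Topology UnitAddTorus Complex AddCircle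
open scoped Real
open Literature.Analysis Literature.Analysis.FunctionSpaces Literature.Analysis.FunctionSpaces.Torus Literature.Analysis.FluidPDE
open Literature.Analysis.FluidPDE.ShearStage
open Literature.Analysis.FluidPDE.SawtoothCascade Literature.Analysis.FluidPDE.SawtoothCascade.CascadeParams
open Summit.AnomalousDissipation.AnomalousDissipation.Theorems.SawtoothPulseCascade.K1Window

/-! ## §1 Reindexing the source sums -/

/-- `Σ_{q ∈ [1, Q]} f q = Σ_{i < Q} f (i + 1)` on `ℤ`. [folklore] -/
theorem sum_Icc_one_eq_sum_range (f : ℤ → ℝ) (Q : ℕ) :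
    ∑ q ∈ Finset.Icc (1 : ℤ) Q, f q = ∑ i ∈ Finset.range Q, f ((i : ℤ) + 1) := by
  induction Q with
  | zero => simp
  | succ Q ih =>
    rw [Finset.sum_range_succ, ← ih]
    have h : Finset.Icc (1 : ℤ) ((Q + 1 : ℕ) : ℤ) = insert (((Q : ℕ) : ℤ) + 1) (Finset.Icc (1 : ℤ) Q) := by
      ext q; simp only [Finset.mem_insert, Finset.mem_Icc]; push_cast; omega
    rw [h, Finset.sum_insert (by simp), add_comm]

/-- `Σ_{q ∈ (Q₁, Q]} f q = Σ_{i < Q − Q₁} f (Q₁ + 1 + i)` on `ℤ` (`Q₁ ≤ Q`). [folklore] -/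
theorem sum_Ioc_eq_sum_range (f : ℤ → ℝ) {Q₁ Q : ℕ} (h : Q₁ ≤ Q) :
    ∑ q ∈ Finset.Ioc (Q₁ : ℤ) Q, f q = ∑ i ∈ Finset.range (Q - Q₁), f ((Q₁ : ℤ) + 1 + i) := by
  obtain ⟨d, rfl⟩ := Nat.exists_eq_add_of_le h
  rw [Nat.add_sub_cancel_left]
  induction d with
  | zero => simp
  | succ d ih =>
    rw [Finset.sum_range_succ, ← ih (Nat.le_add_right _ _)]
    have e : Finset.Ioc (Q₁ : ℤ) ((Q₁ + (d + 1) : ℕ) : ℤ) = insert ((Q₁ : ℤ) + 1 + d) (Finset.Ioc (Q₁ : ℤ) ((Q₁ + d : ℕ) : ℤ)) := by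
      ext q; simp only [Finset.mem_insert, Finset.mem_Ioc]; push_cast; omega
    rw [e, Finset.sum_insert (by simp), add_comm]

/-- `(v + ρ)² ≤ 5/4·v² + 5ρ²`. [folklore] -/
theorem add_sq_le_five_quarters (v ρ : ℝ) : (v + ρ) ^ 2 ≤ 5 / 4 * v ^ 2 + 5 * ρ ^ 2 := by
  nlinarith [sq_nonneg (v / 2 - 2 * ρ)]

/-! ## §2 The evaluation form -/

section Cascade

variable (P : CascadeParams)

/-- **THE PER-FIBRE T-H BOUND, EVALUATION FORM**: the data `(K′, Q_c, Q₁, K₁, K, s, v)` of a fibre `n ≥ 1` with the numeric side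
conditions `Q₁ ≤ Q_c`, `K₁ ≤ K`, `4K < 8n`, `K′ + Q₁ + 1 ≤ 4K`, `0 ≤ s`, `Bw(n;K₁,K) ≤ s²` and
`2(s + 2⁻²⁷n)·Σ_{i<Q₁} Ā(n,i+1) + 2·Σ_{i<Q_c−Q₁} Ā(n,Q₁+1+i) ≤ v` give `√X_n ≤ v + ρ_n`. [cite: Grafakos2014, Prop. 3.1.2 (5), Prop. 3.2.7 (3)] -/
theorem phaseOne_hfibre_sqrt_le_eval (hγ : P.γ = 8) (hN₀ : P.N₀ = 1) (hρN : P.ρN = 2) (hd : P.d = 2) (hδ₀ : 0 < P.δ₀)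
    (hδ₀' : P.δ₀ ≤ (2 : ℝ)⁻¹ ^ 30) (a b : ℕ → UnitAddTorus (Fin 2) → ℝ) (h0 : a 0 = datum)
    (hb : ∀ j, b j = a j ∘ shearMap 0 1 (amp ⟨P.U j, P.U_periodic j, P.contDiff_U (P.δ_pos hδ₀ (by rw [hd]; norm_num) j)⟩ P.γ))
    (hab : ∀ j, a (j + 1) = b j ∘ shearMap 1 0 (amp ⟨P.U j, P.U_periodic j, P.contDiff_U (P.δ_pos hδ₀ (by rw [hd]; norm_num) j)⟩ P.γ))
    (Kp Qc Q₁ K₁ K : ℕ) (n : ℕ) (hn : 1 ≤ n) (hQ : Q₁ ≤ Qc) (hK₁ : K₁ ≤ K) (hK : 4 * (K : ℝ) < 8 * n)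
    (hwin : Kp + Q₁ + 1 ≤ 4 * K) {s v : ℝ} (hs0 : 0 ≤ s)
    (hs : 2 * (32 * (n : ℝ) * 0.31831) ^ 2 * (1 / 4 * ((1 / (8 * (n : ℝ))) ^ 2 * (1 / (8 * (n : ℝ) - 4 * K₁) - 1 / (8 * (n : ℝ))) +
        (1 / (8 * (n : ℝ) + 4 * K₁ + 2)) ^ 2 * (1 / (8 * (n : ℝ) - 4 * K) - 1 / (8 * (n : ℝ) - 4 * K₁)))) ≤ s ^ 2)
    (hv : 2 * (s + (2 : ℝ)⁻¹ ^ 27 * n) * ∑ i ∈ Finset.range Q₁,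
          1 / 2 * ((if ((i : ℤ) + 1) = 8 ∨ ((i : ℤ) + 1) = -8 then (1 / 2 : ℝ) else if ((i : ℤ) + 1) % 2 = 0 then 0
              else 16 * 0.31831 / |64 - ((((i : ℤ) + 1 : ℤ)) : ℝ) ^ 2|) + (2 : ℝ)⁻¹ ^ 25) *
            ((if 8 * ((i : ℤ) + 1) + ((n : ℤ) + 1) = 0 ∨ 8 * ((i : ℤ) + 1) - ((n : ℤ) + 1) = 0 then (1 / 2 : ℝ)
                else if ((n : ℤ) + 1) % 2 = 0 then 0
                else 16 * |((((i : ℤ) + 1 : ℤ)) : ℝ)| * 0.31831 / |64 * ((((i : ℤ) + 1 : ℤ)) : ℝ) ^ 2 - (((n : ℤ) + 1 : ℤ) : ℝ) ^ 2|) +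
              (if 8 * ((i : ℤ) + 1) + ((n : ℤ) - 1) = 0 ∨ 8 * ((i : ℤ) + 1) - ((n : ℤ) - 1) = 0 then (1 / 2 : ℝ)
                else if ((n : ℤ) - 1) % 2 = 0 then 0
                else 16 * |((((i : ℤ) + 1 : ℤ)) : ℝ)| * 0.31831 / |64 * ((((i : ℤ) + 1 : ℤ)) : ℝ) ^ 2 - (((n : ℤ) - 1 : ℤ) : ℝ) ^ 2|) +
              2 * |((((i : ℤ) + 1 : ℤ)) : ℝ)| * (2 : ℝ)⁻¹ ^ 25) +
        2 * ∑ i ∈ Finset.range (Qc - Q₁),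
          1 / 2 * ((if ((Q₁ : ℤ) + 1 + i) = 8 ∨ ((Q₁ : ℤ) + 1 + i) = -8 then (1 / 2 : ℝ) else if ((Q₁ : ℤ) + 1 + i) % 2 = 0 then 0
              else 16 * 0.31831 / |64 - ((((Q₁ : ℤ) + 1 + i : ℤ)) : ℝ) ^ 2|) + (2 : ℝ)⁻¹ ^ 25) *
            ((if 8 * ((Q₁ : ℤ) + 1 + i) + ((n : ℤ) + 1) = 0 ∨ 8 * ((Q₁ : ℤ) + 1 + i) - ((n : ℤ) + 1) = 0 then (1 / 2 : ℝ)
                else if ((n : ℤ) + 1) % 2 = 0 then 0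
                else 16 * |((((Q₁ : ℤ) + 1 + i : ℤ)) : ℝ)| * 0.31831 / |64 * ((((Q₁ : ℤ) + 1 + i : ℤ)) : ℝ) ^ 2 - (((n : ℤ) + 1 : ℤ) : ℝ) ^ 2|) +
              (if 8 * ((Q₁ : ℤ) + 1 + i) + ((n : ℤ) - 1) = 0 ∨ 8 * ((Q₁ : ℤ) + 1 + i) - ((n : ℤ) - 1) = 0 then (1 / 2 : ℝ)
                else if ((n : ℤ) - 1) % 2 = 0 then 0
                else 16 * |((((Q₁ : ℤ) + 1 + i : ℤ)) : ℝ)| * 0.31831 / |64 * ((((Q₁ : ℤ) + 1 + i : ℤ)) : ℝ) ^ 2 - (((n : ℤ) - 1 : ℤ) : ℝ) ^ 2|) +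
              2 * |((((Q₁ : ℤ) + 1 + i : ℤ)) : ℝ)| * (2 : ℝ)⁻¹ ^ 25) ≤ v) :
    Real.sqrt (∑ m ∈ Finset.Ioo (-(Kp : ℤ)) Kp, ‖mFourierCoeff (fun x => (b 1 x : ℂ)) ![(n : ℤ), m]‖ ^ 2) ≤
      v + Real.sqrt (∑' q : ℤ, if 1 ≤ |q| ∧ |q| ≤ (Qc : ℤ) then 0 else ‖mFourierCoeff (fun x => (a 1 x : ℂ)) ![(n : ℤ), q]‖ ^ 2) := by
  have hn0 : ((n : ℤ)) ≠ 0 := by exact_mod_cast (by omega : n ≠ 0)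
  have habs : |((n : ℤ) : ℝ)| = n := by push_cast; exact abs_of_nonneg (Nat.cast_nonneg n)
  have hK' : 4 * (K : ℝ) < 8 * |((n : ℤ) : ℝ)| := by rw [habs]; exact hK
  have hs' : 2 * (32 * |((n : ℤ) : ℝ)| * 0.31831) ^ 2 * (1 / 4 * ((1 / (8 * |((n : ℤ) : ℝ)|)) ^ 2 *
      (1 / (8 * |((n : ℤ) : ℝ)| - 4 * K₁) - 1 / (8 * |((n : ℤ) : ℝ)|)) + (1 / (8 * |((n : ℤ) : ℝ)| + 4 * K₁ + 2)) ^ 2 *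
      (1 / (8 * |((n : ℤ) : ℝ)| - 4 * K) - 1 / (8 * |((n : ℤ) : ℝ)| - 4 * K₁)))) ≤ s ^ 2 := by rw [habs]; exact hs
  have h := phaseOne_hfibre_sqrt_le P hγ hN₀ hρN hd hδ₀ hδ₀' a b h0 hb hab Kp Qc Q₁ K₁ K hn0 hQ hK₁ hK' hwin hs0 hs'
  refine h.trans (add_le_add ?_ le_rfl)
  rw [habs, sum_Icc_one_eq_sum_range, sum_Ioc_eq_sum_range _ hQ]
  refine le_trans (le_of_eq ?_) hv
  push_cast
  rfl

/-- **The squared form**: with the data of `phaseOne_hfibre_sqrt_le_eval` and `0 ≤ v`, `X_n ≤ 5/4·v² + 5·ρ_n²`.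
[cite: Grafakos2014, Prop. 3.2.7 (3)] -/
theorem phaseOne_hfibre_sq_le_of_sqrt {X v R : ℝ} (hX : 0 ≤ X) (hR : 0 ≤ R) (hv : 0 ≤ v)
    (h : Real.sqrt X ≤ v + Real.sqrt R) : X ≤ 5 / 4 * v ^ 2 + 5 * R := by
  have h0 : 0 ≤ v + Real.sqrt R := by positivity
  have h1 : X ≤ (v + Real.sqrt R) ^ 2 := by
    calc X = Real.sqrt X ^ 2 := (Real.sq_sqrt hX).symm
      _ ≤ (v + Real.sqrt R) ^ 2 := pow_le_pow_left₀ (Real.sqrt_nonneg _) h 2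
  have h2 := add_sq_le_five_quarters v (Real.sqrt R)
  rw [Real.sq_sqrt hR] at h2
  linarith

end Cascade

end Summit.AnomalousDissipation.AnomalousDissipation.Theorems.SawtoothPulseCascade.K1Start
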